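import Mathlib
import HarnessLib
import HarnessLib.Audit
import Summits.SmoothPoincare4.Statement
import Literature.Topology.FourManifolds.RLinkSphere
import Literature.Topology.FourManifolds.HomotopySpheres
import Literature.Topology.FourManifolds.Morse
import Literature.Topology.FourManifolds.HomotopyS4CompactProofs
import Literature.Topology.FourManifolds.HomotopyS4OrientableProofs
import HarnessLib.Audit.Status.Attr

/-!
Route: RootDecompD

# Route RootDecompD — Root decomposition D (RLinkCensusSplit, lens 5) — 1-handle-free Morse
functions (item 0378, imported residual), the finite R-link census below 16 crossings (attacked),
and its tail (declared residual)

ROOT DECOMPOSITION NODE D of cell decomp-sp4 (D-0178, LADDER-SmoothPoincare4 rung 0; lens 5 = finite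
range ∧ asymptotic regime ∧ bridge; node RLinkCensusSplit, adopted by the route-writer as OR-sibling
RootDecompD in the DEDUPLICATED form A′). TARGET = the ROOT `_root_.SmoothPoincare4` verbatim ⟸
NoOneHandlesExist (C1 = item stmt-SmoothPoincare4-0378 of route NoOneHandles VERBATIM, imported
residual) ∧ MorseGscIsRLinkSphere (support, the Morse → handlebody bridge W1) ∧
SmallRLinkSpheresStandard (F(16), attacked) ∧ GscSpheresHaveSmallDiagrams (T(16), declared
residual). It suffices to show X = C1 ∧ F(16) ∧ T(16) over the support: (C1) every smooth homotopy
4-sphere carries a Morse function without index-1 critical points (Kirby 4.18 on homotopy spheres;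
the support turns such a function into an R-link presentation Σ = Σ_L, i.e. a handle decomposition
0h ∪ 2h(L) ∪ 3h ∪ 4h); (F(16) = SmallRLinkSpheresStandard) every homotopy sphere Σ_L whose R-link L
has at most 16 components and lies in regular position with at most 16 crossings is diffeomorphic to
S⁴ — a FINITE census; (T(16) = GscSpheresHaveSmallDiagrams) every homotopy sphere that is an R-link
sphere at all has such a small presentation — the DECLARED RESIDUAL bridge. F(N) ∧ T(N) ⟺
NoohGscStandard #0377 in handlebody form for every N (lens kernel gscStandard_iff_split),
SmoothPoincare4 ⟺ GscExists ∧ F(16) ∧ T(16) (lens kernel summit_iff_split), F antitone and T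
monotone in the dial N. SmoothPoincare4 is NOT proved by anything here: C1, F(16), T(16) are open
S-implied statements and the support is a textbook handle-theory fact not yet in the tree; for
tribunal scoring F(16) is the attacked conjunct, C1 (owner NoOneHandles) and T(16) are DECLARED
RESIDUAL.
Lean: `(∀ S : Literature.Topology.FourManifolds.HomotopySphere 4, ∃ f : S.carrier → ℝ,
Literature.Topology.FourManifolds.IsMorse (𝓡 4) f ∧
Literature.Topology.FourManifolds.criticalSetOfIndex (𝓡 4) f 1 = ∅) ∧ (open scoped ContDiff in ∀ (M
: Type) [TopologicalSpace M] [T2Space M] [SecondCountableTopology M] [ChartedSpace (EuclideanSpace ℝ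
(Fin 4)) M] [IsManifold (𝓡 4) ∞ M], ContinuousMap.HomotopyEquiv M (Metric.sphere (0 : EuclideanSpace
ℝ (Fin 5)) 1) → (∃ (n : ℕ) (L : Literature.Topology.FourManifolds.FramedLink (Fin n)) (γ : Fin n → ℝ
→ ℝ × ℝ) (C : Set ((Fin n × ℝ) × (Fin n × ℝ))), (∀ a t, γ a t = (((1 - (L.toLink.component a
(Literature.Topology.FourManifolds.circlePoint t)).1 3)⁻¹ * (L.toLink.component a
(Literature.Topology.FourManifolds.circlePoint t)).1 0), ((1 - (L.toLink.component a
(Literature.Topology.FourManifolds.circlePoint t)).1 3)⁻¹ * (L.toLink.component a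
(Literature.Topology.FourManifolds.circlePoint t)).1 1))) ∧ C = {p | p.1 ≠ p.2 ∧ p.1.2 ∈ Set.Ico (0
: ℝ) (2 * Real.pi) ∧ p.2.2 ∈ Set.Ico (0 : ℝ) (2 * Real.pi) ∧ γ p.1.1 p.1.2 = γ p.2.1 p.2.2} ∧ n ≤ 16
∧ (∀ a z, (L.toLink.component a z).1 3 ≠ 1) ∧ (∀ a t, deriv (γ a) t ≠ 0) ∧ C.Finite ∧ (∀ p ∈ C,
(deriv (γ p.1.1) p.1.2).1 * (deriv (γ p.2.1) p.2.2).2 ≠ (deriv (γ p.1.1) p.1.2).2 * (deriv (γ p.2.1)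
p.2.2).1) ∧ C.ncard ≤ 32 ∧ Literature.Topology.FourManifolds.IsRLinkSphere M L) → Nonempty (M ≃ₘ⟮𝓡
4, 𝓡 4⟯ (Metric.sphere (0 : EuclideanSpace ℝ (Fin 5)) 1))) ∧ (open scoped ContDiff in ∀ (M : Type)
[TopologicalSpace M] [T2Space M] [SecondCountableTopology M] [ChartedSpace (EuclideanSpace ℝ (Fin
4)) M] [IsManifold (𝓡 4) ∞ M], ContinuousMap.HomotopyEquiv M (Metric.sphere (0 : EuclideanSpace ℝ
(Fin 5)) 1) → (∃ (n : ℕ) (L : Literature.Topology.FourManifolds.FramedLink (Fin n)),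
Literature.Topology.FourManifolds.IsRLinkSphere M L) → (∃ (n : ℕ) (L :
Literature.Topology.FourManifolds.FramedLink (Fin n)) (γ : Fin n → ℝ → ℝ × ℝ) (C : Set ((Fin n × ℝ)
× (Fin n × ℝ))), (∀ a t, γ a t = (((1 - (L.toLink.component a
(Literature.Topology.FourManifolds.circlePoint t)).1 3)⁻¹ * (L.toLink.component a
(Literature.Topology.FourManifolds.circlePoint t)).1 0), ((1 - (L.toLink.component a
(Literature.Topology.FourManifolds.circlePoint t)).1 3)⁻¹ * (L.toLink.component a
(Literature.Topology.FourManifolds.circlePoint t)).1 1))) ∧ C = {p | p.1 ≠ p.2 ∧ p.1.2 ∈ Set.Ico (0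
: ℝ) (2 * Real.pi) ∧ p.2.2 ∈ Set.Ico (0 : ℝ) (2 * Real.pi) ∧ γ p.1.1 p.1.2 = γ p.2.1 p.2.2} ∧ n ≤ 16
∧ (∀ a z, (L.toLink.component a z).1 3 ≠ 1) ∧ (∀ a t, deriv (γ a) t ≠ 0) ∧ C.Finite ∧ (∀ p ∈ C,
(deriv (γ p.1.1) p.1.2).1 * (deriv (γ p.2.1) p.2.2).2 ≠ (deriv (γ p.1.1) p.1.2).2 * (deriv (γ p.2.1)
p.2.2).1) ∧ C.ncard ≤ 32 ∧ Literature.Topology.FourManifolds.IsRLinkSphere M L))`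

## Assembly
Packaging plus pure logic, pointwise in M: given M ≃ₕ S⁴ the PROVED tree theorems
`compactSpace_of_homotopyEquiv_sphere_four_holds` and
`isOrientable_of_homotopyEquiv_sphere_four_holds` package M as a `HomotopySphere 4`; C1 gives a
1-handle-free Morse function, the support an R-link presentation, T(16) a small one, F(16) the
diffeomorphism:
`theorem closes (hC : NoOneHandlesExist) (hW : MorseGscIsRLinkSphere) (hF :
SmallRLinkSpheresStandard) (hT : GscSpheresHaveSmallDiagrams) : _root_.SmoothPoincare4`
(glue.w.lean, kernel-checked by the writer in l5/SketchD.lean, rc 0 / 0 sorry, together with the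
support's S-necessity `morseGscIsRLinkSphere_of_spc4`; the lens file RLinkCensusSplit.lean
kernel-checks the handlebody form: closes, the converse summit_iff_split, the split
gscStandard_iff_split N and the dial lemmas censusBelow_anti / tailBelow_mono).

Rationale: WHY THIS LINE. Gompf–Scharlemann–Thompson (GompfScharlemannThompson2010 §9, Prop 9.2;
arXiv:1103.1601) identify homotopy 4-spheres without
1-handles with R-link spheres Σ_L (0-framed links whose surgery is #ⁿS¹×S²) and the weak generalised
Property R conjecture with
their standardness; route NoOneHandles carries exactly this pair (#0378 ∧ #0377). This line cuts the
infinite recognition half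

RANKED CRUXES. #2 SmallRLinkSpheresStandard (crux) — F(16), the FINITE CENSUS (tags WEAKER ·
INSTRUMENTABLE): every smooth homotopy 4-sphere M that is an R-link sphere Σ_L (IsRLinkSphere M L)
for a framed link L with n ≤ 16 components in regular position w.r.t. the fixed stereographic
projection with at most 16 crossings (components miss the pole, plane curves γ immersed,
crossing-pair set C finite, transverse, C.ncard ≤ 32) is diffeomorphic to S⁴. Sub-ranges known: n =
1 (Property R, Gabai1987), generalised square knots (MeierZupan2022 Thm 1.1), ≤ 14 crossings
machine-certified (41/41, census rows F9/Φ3); 15–16 crossings = census test M2 (≈ 70 core-h). Critic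
verdict: WEAKER (finite S-implied sub-statement of #0377; sub-ranges in print: Property R n = 1,
MZ22 Thm 1.1, GST rows; ≤ 14 crossings machine-certified 41/41, census F9/Φ3 — evidence-level) ·
UNDECIDED at 15–16 (test M2 ≈70 core-h; pre-test R-link filter ≤ 2 core-h) · INSTRUMENTABLE; P3
letter satisfied, scope may contain no hard specimen (a near-theorem by design, which is what a
finite piece is for) — CLEARED decomp-sp4-crit-1-g0 2026-08-30T01:43:40Z; attacked (node score).
[difficulty: L] (why it might fail: an R-link with 15–16 crossings whose sphere Σ_L resists every
Kirby-calculus certificate (even after 1-handle stabilisation) would be the first live 1-handle-free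
fake-sphere candidate; M2 has not been run, and GST-type links show slide-certificates can be
unexpectedly hard.) [GompfScharlemannThompson2010, arXiv:1103.1601, MeierZupan2022,
arXiv:2604.17737, Gabai1987, HosteThistlethwaiteWeeks1998]
#3 NoOneHandlesExist (crux) — C1 (tags IMPORTED RESIDUAL · IDEA-NEEDED; = item
stmt-SmoothPoincare4-0378 `NoOneHandles.NoohNoOneHandles` VERBATIM, dedup by signature intended,
owner route NoOneHandles): every smooth homotopy 4-sphere (packaged `HomotopySphere 4`: compact,
oriented — both PROVED consequences of M ≃ₕ S⁴ in the tree) admits a Morse function with no critical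
points of index 1 (Kirby Problem 4.18 restricted to homotopy spheres; with the support
MorseGscIsRLinkSphere this is exactly «Σ is an R-link sphere Σ_L», the lens's GscExists). No seat
asked by this node. Critic verdict: IMPORTED RESIDUAL (= #0378; WEAKER by the registry: gives S only
with #0377) · IDEA-NEEDED — CLEARED decomp-sp4-crit-1-g0 2026-08-30T01:43:40Z; the writer answers
the critic's birth caveat («a 4th root route would create GscExists as a parallel re-typing of #0378
with no kernel bridge») by importing #0378 VERBATIM and filing the bridge as the support item below.
[difficulty: open-problem] (why it might fail: Kirby 4.18 is open even for homotopy spheres: an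
exotic Σ all of whose handle decompositions need 1-handles refutes it (SPC4-shielded); smoothly
trading 1-handles for 3-handles needs embedded discs that Freedman–Quinn give only topologically.)
[Kirby1997, GompfStipsicz1999, GompfScharlemannThompson2010]
#4 GscSpheresHaveSmallDiagrams (crux) — T(16), the TAIL / BRIDGE (tags UNDECIDED · DECLARED RESIDUAL
· IDEA-NEEDED): every smooth homotopy 4-sphere that is an R-link sphere at all is one for an R-link
with ≤ 16 components in regular position with ≤ 16 crossings. S-implied (S⁴ = Σ_∅); T(16) ⇒ #0377
only given F(16); #0377 ⇒ T(N) for all N; T monotone in N; T(∞) is general position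
(Reidemeister1932). Equivalent to: the minimal R-link crossing number of GSC homotopy 4-spheres is
bounded by 16 — finiteness and smallness of 1-handle-free exotica; test = census M2 (certify all, or
name the first resisting R-link = next dial value). Critic verdict: DECLARED-RESIDUAL ≡ #0377 modulo
F(16) (kernel gscStandard_iff_split; COSTUME-given-F relative to #0377, WEAKER-than-S by domination
#0377 ⟹ T(N)) · UNDECIDED (test M2) · dial correction W2 accepted (raising N re-labels T and banks a
larger finite theorem F(N); it does not reduce the residual) — CLEARED decomp-sp4-crit-1-g0
2026-08-30T01:43:40Z; no seat asked. [deps: SmallRLinkSpheresStandard] [difficulty: open-problem]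
(why it might fail: nothing bounds the diagram complexity of a fake GSC sphere: a GSC exotic Σ whose
every R-link needs ≥ 17 crossings makes T(16) false while S may still hold for the census range —
then the dial moves (T(N) for larger N), the line is not killed.) [GompfScharlemannThompson2010,
arXiv:2604.17737, Reidemeister1932, KervaireMilnor1963]
#9 MorseGscIsRLinkSphere (support) — the Morse → handlebody bridge (lens W1; support, not a crux): a
smooth homotopy 4-sphere carrying a Morse function without index-1 critical points is an R-link
sphere Σ_L for some framed link L ⊂ S³ (handle decomposition from a generic Morse function, Milnor /
GompfStipsicz1999 §4.2; no 1-handles ⇒ the 2-handles attach to B⁴ along a framed link whose trace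
has boundary #ⁿ S¹ × S², and the 3/4-handles form a (0;n·1)-handlebody by χ = 2 —
GompfScharlemannThompson2010 §9). S-implied trivially (S⁴ = Σ_∅: tree
`isRLinkSphere_sphere_four_empty` + `IsRLinkSphere.of_diffeomorph`, kernel-checked in the writer
sketch). A textbook fact absent from the tree; provable by anyone idle once
`IsMorse`-to-handle-decomposition infrastructure exists. [difficulty: M] [GompfStipsicz1999,
GompfScharlemannThompson2010, Milnor1963]

TWO-LAYER PLAN. SmallRLinkSpheresStandard ⇐ [F(14): the 41 certified multi-component R-links ≤ 14
crossings + Property R rows, replayable as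
kernel certificates once a Kirby-certificate replayer for IsRLinkSphere exists] → [F(15..16) : the
M2 output] → F(16). GscSpheresHaveSmallDiagrams
is re-dialled, not split: after M2, file F(18)/T(18) (tailBelow_mono gives T(16) → T(18);
smoothPoincare4_iff_split 18 keeps exactness; NB critic W2: modulo the banked census the residual is
re-labelled, not reduced — given F(18), T(16) ⟺ T(18) ⟺ #0377; what grows is the banked finite
theorem F(N)). Nothing filed now.

KILL CRITERIA. A refutation of SmallRLinkSpheresStandard (an R-link sphere of ≤ 16 crossings proved
exotic) refutes SPC4 itself: close refuted:SmallRLinkSpheresStandard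
and the summit is decided negatively. A refutation of GscSpheresHaveSmallDiagrams alone (a GSC
homotopy sphere provably needing ≥ 17 crossings but not
known exotic) forces a PIVOT: re-dial to T(c) with c its crossing number (route edit, same line). If
NoohGscStandard #0377 is proved elsewhere, F and T
become corollaries (gscStandard_iff_split) and the route is superseded --by NoOneHandles; if #0378
is refuted (a homotopy sphere needing 1-handles),
C1 dies and with it this line and NoOneHandles.

NOT DECOMPOSED YET. The census F(16) into its finitely many rows (one support item per certified
R-link type needs a typed certificate replayer: FramedLink Kirby moves →
IsRLinkSphere diffeomorphism, tree KirbyMoves.lean / RLinkSphere.lean); the dictionary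
Morse-function-without-index-1 (#0378 verbatim) ↔ IsGsc
(handlebody form) — a layer-2 support lemma if the writer wants C1 to be literally item #0378;
isotopy invariance of "Σ_L" (FramedLink.IsTrace) used
informally when passing from link types to geometric links.

CHEAPEST FALSIFIER. Lookup + census: is any R-link of ≤ 16 crossings known whose sphere is suspected
exotic, or any GSC homotopy sphere known to need large diagrams? None in
print (GST L_n,k and MZ families satisfy weak GPR: arXiv:2604.17737 pp.2–3; census Φ3: undecided
only ≥ 15 crossings). In-Lean: the C → S probes for each
crux fail (bc/), the inline items agree with the structured defs and summit_iff_split holds for them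
(bc/RouteItemsAgree.lean rc 0). The decisive cheap
run is census test M2 (70 core-h, not purchasable by this seat: kit_allowed = false).

NUMBERS. Dial N₀ = 16 (components ≤ 16, crossings ≤ 16, C.ncard ≤ 32 ordered crossing pairs).
Certified range: ≤ 14 crossings, 41 multi-component R-links
(36 two-component, 5 three-component), all standard (pub-sp4inv p3/certs/rlinks; census
COSTUME-CENSUS-v1 F9/Φ3). Priced: M2 = 15–16 crossings ≈ 70
core-h. Lower bound certified today on the R-link crossing number of any 1-handle-free exotic S⁴: ≥
15.

DEFINITION REQUESTS. None required for birth: the items are inlined over tree carriers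
(Literature.Topology.FourManifolds.FramedLink / IsRLinkSphere / circlePoint, Mathlib
deriv / Set.ncard). Optional (writer): land the structured vocabulary of the cell file (planarProj,
planeCurveOf, crossingPairs, HasDiagramComplexityLE,
IsGsc, HasSmallRLinkDiagram, CensusBelow, TailBelow + dial lemmas) as
Summits/SmoothPoincare4/SmoothPoincare4/Theorems/RLinkDiagramComplexity.lean so
that re-dialled items read `CensusBelow N` / `TailBelow N`; bc/RouteItemsAgree.lean proves the
inline items ↔ the structured ones.

Novelty: Searches (2026-08-30): rg over 68 Summits/SmoothPoincare4/SmoothPoincare4/Theses/*.lean for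
census|crossing|pentachora|complexity (0 complexity-indexed
pieces; census only in LADDER §C3 rungs); ledger negatives --problem SmoothPoincare4 (no census/tail
statement); lit search --hybrid "R-link generalized
property R crossings census" (hits: paper:arxiv-2604.17737 pp.2–3 = GST/MZ families only;
arxiv-1103.1601); lit galaxy search "generalized Property R|R-link"
--star all (no census beyond families); lit search "census 4-sphere triangulations pentachora"
([corpus:paper:arxiv-2412.04768 p.2], PL side, untypable
here); cell census COSTUME-CENSUS-v1 rows F9/Φ3/M2 (our certified range ≤ 14).
Nearest prior art found: GompfScharlemannThompson2010 / arXiv:1103.1601 (R-link spheres, weak GPR ⟺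
GSC spheres standard, Prop 9.2); arXiv:2604.17737
(2026 computer experiments on GST/MZ R-links, Conj 1.3); route NoOneHandles (#0378 ∧ #0377) in the
tree; LADDER §C3 census rungs.
Delta: types the missing implication between a finite R-link census and the recognition half of
NoOneHandles as an S-implied, dial-monotone tail
statement, so that certified census levels bank as progress on a root node (gscStandard_iff_split)
instead of calibration.
Claimed grade: new-combination  [refs: 1103.1601, 2604.17737, paper:arxiv-2604.17737, arxiv-1103.1601, paper:arxiv-2412.04768, GompfScharlemannThompson2010]

Barriers (technique_class: kirby-calculus, certified-computation, generalized-property-r): - technique_class: kirby-calculus, certified-computation, generalized-property-r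
- BARRIERS.lean §A16 (PropertyTwoRAndrewsCurtis.lean, StrictPropertyTwoRBarrier /
PropertyTwoRBarrier; outside the gate catalogue, cited as prose — strict generalised Property R /
AC-type statements are not S-implied): evaded — no item asserts slide-equivalence or AC-triviality;
certificates for census rows may stabilise by 1-handles; every item is S-implied (lens kernel
summit_iff_split →; the support by the empty R-link).
- LADDER.md §C3 (census rungs «do NOT give anything about all Σ»): acknowledged and made explicit —
the gap is exactly the declared residual GscSpheresHaveSmallDiagrams; the census piece alone is
never rendered as distance to the summit.
- BARRIERS.lean §D.1 (SPC4-shielding: pieces ∀ Σ ≃ₕ S⁴ … are unrefutable short of an exotic S⁴):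
applies to all items by design of a NECESSARY decomposition; WEAKER is argued by finiteness (F),
registered dominators (#0377 ⇒ F, #0377 ⇒ T, C1 = #0378 itself) and the monotone dial, not by
refutability; T is refutable in principle by exhibiting a GSC homotopy sphere with certified minimal
R-link crossing number ≥ 17.
- Literature.Barriers.SmoothPoincare4.GaugeSumBarrierFour and
Literature.Barriers.SmoothPoincare4.HCobordismInvariantBarrierFour (gauge / h-cobordism-invariant
blindness on homotopy spheres): OUTSIDE — no invariant is computed; the instrument is constructive
Kirby calculus on explicit R-link diagrams.
- Literature.Barriers.SmoothPoin

sub-problem: SmoothPoincare4 · status: open · opened planner-decomp-sp4-writer-1-g0-0 2026-08-30T02:29:15Z · rev 0 · ledger route-SmoothPoincare4-RootDecompD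
GENERATED by the gate from the ledger (D-0016/17). Provers cite these decls: `theorem foo : Summit.SmoothPoincare4.SmoothPoincare4.Theses.RootDecompD.<Decl> := …` in Summits/SmoothPoincare4/SmoothPoincare4/Theorems/<Name>.lean.
-/

namespace Summit.SmoothPoincare4.SmoothPoincare4.Theses.RootDecompD

open scoped BigOperators Topology Manifold Classical MeasureTheory ProbabilityTheory Matrix InnerProductSpace ComplexConjugate ContinuousMap
open Filter Set Function TopologicalSpace MeasureTheory

attribute [summit_statement] _root_.SmoothPoincare4

open Literature.SPC4

/-- item stmt-SmoothPoincare4-25267 · crux · rank 2 · open · by planner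
why it might fail: an R-link with 15–16 crossings whose sphere Σ_L resists every Kirby-calculus certificate (even after 1-handle stabilisation) would be the first live 1-handle-free fake-sphere candidate; M2 has not been run, and GST-type links show slide-certificates can be unexpectedly hard.
sources: GompfScharlemannThompson2010, arXiv:1103.1601, MeierZupan2022, arXiv:2604.17737, Gabai1987, HosteThistlethwaiteWeeks1998
[crux] F(16), the FINITE CENSUS (tags WEAKER · INSTRUMENTABLE): every smooth homotopy 4-sphere M
that is an R-link sphere Σ_L (IsRLinkSphere M L) for a framed link L with n ≤ 16 components in
regular position w.r.t. the fixed stereographic projection with at most 16 crossings (components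
miss the pole, plane curves γ immersed, crossing-pair set C finite, transverse, C.ncard ≤ 32) is
diffeomorphic to S⁴. Sub-ranges known: n = 1 (Property R, Gabai1987), generalised square knots
(MeierZupan2022 Thm 1.1), ≤ 14 crossings machine-certified (41/41, census rows F9/Φ3); 15–16
crossings = census test M2 (≈ 70 core-h). Critic verdict: WEAKER (finite S-implied sub-statement of
#0377; sub-ranges in print: Property R n = 1, MZ22 Thm 1.1, GST rows; ≤ 14 crossings
machine-certified 41/41, census F9/Φ3 — evidence-level) · UNDECIDED at 15–16 (test M2 ≈70 core-h;
pre-test R-link filter ≤ 2 core-h) · INSTRUMENTABLE; P3 letter satisfied, scope may contain no hard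
specimen (a near-theorem by design, which is what a finite piece is for) — CLEARED
decomp-sp4-crit-1-g0 2026-08-30T01:43:40Z; attacked (node score). [difficulty: L] -/
@[route_item "route-SmoothPoincare4-RootDecompD", crux]
def SmallRLinkSpheresStandard : Prop :=
  open scoped ContDiff in ∀ (M : Type) [TopologicalSpace M] [T2Space M] [SecondCountableTopology M] [ChartedSpace (EuclideanSpace ℝ (Fin 4)) M] [IsManifold (𝓡 4) ∞ M], ContinuousMap.HomotopyEquiv M (Metric.sphere (0 : EuclideanSpace ℝ (Fin 5)) 1) → (∃ (n : ℕ) (L : Literature.Topology.FourManifolds.FramedLink (Fin n)) (γ : Fin n → ℝ → ℝ × ℝ) (C : Set ((Fin n × ℝ) × (Fin n × ℝ))), (∀ a t, γ a t = (((1 - (L.toLink.component a (Literature.Topology.FourManifolds.circlePoint t)).1 3)⁻¹ * (L.toLink.component a (Literature.Topology.FourManifolds.circlePoint t)).1 0), ((1 - (L.toLink.component a (Literature.Topology.FourManifolds.circlePoint t)).1 3)⁻¹ * (L.toLink.component a (Literature.Topology.FourManifolds.circlePoint t)).1 1))) ∧ C = {p | p.1 ≠ p.2 ∧ p.1.2 ∈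 Set.Ico (0 : ℝ) (2 * Real.pi) ∧ p.2.2 ∈ Set.Ico (0 : ℝ) (2 * Real.pi) ∧ γ p.1.1 p.1.2 = γ p.2.1 p.2.2} ∧ n ≤ 16 ∧ (∀ a z, (L.toLink.component a z).1 3 ≠ 1) ∧ (∀ a t, deriv (γ a) t ≠ 0) ∧ C.Finite ∧ (∀ p ∈ C, (deriv (γ p.1.1) p.1.2).1 * (deriv (γ p.2.1) p.2.2).2 ≠ (deriv (γ p.1.1) p.1.2).2 * (deriv (γ p.2.1) p.2.2).1) ∧ C.ncard ≤ 32 ∧ Literature.Topology.FourManifolds.IsRLinkSphere M L) → Nonempty (M ≃ₘ⟮𝓡 4, 𝓡 4⟯ (Metric.sphere (0 : EuclideanSpace ℝ (Fin 5)) 1))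

/-- item stmt-SmoothPoincare4-0378 · crux · rank 3 · open · by planner
why it might fail: Kirby 4.18 is open even for homotopy spheres: an exotic Σ all of whose handle decompositions need 1-handles refutes it (SPC4-shielded); smoothly trading 1-handles for 3-handles needs embedded discs that Freedman–Quinn give only topologically.
sources: Kirby1997, GompfStipsicz1999, GompfScharlemannThompson2010
Kirby Problem 4.18 (for all closed simply connected 4-manifolds) specialised to homotopy spheres. No
obstruction known; 1-handle ↔ 3-handle trading needs an embedded-disc input. Sources: Kirby1997
4.18; GompfStipsicz1999 §5.1. -/
@[route_item "route-SmoothPoincare4-RootDecompD", crux]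
def NoOneHandlesExist : Prop :=
  ∀ S : Literature.Topology.FourManifolds.HomotopySphere 4, ∃ f : S.carrier → ℝ, Literature.Topology.FourManifolds.IsMorse (𝓡 4) f ∧ Literature.Topology.FourManifolds.criticalSetOfIndex (𝓡 4) f 1 = ∅

/-- item stmt-SmoothPoincare4-25268 · crux · rank 4 · open · by planner
why it might fail: nothing bounds the diagram complexity of a fake GSC sphere: a GSC exotic Σ whose every R-link needs ≥ 17 crossings makes T(16) false while S may still hold for the census range — then the dial moves (T(N) for larger N), the line is not killed.
sources: GompfScharlemannThompson2010, arXiv:2604.17737, Reidemeister1932, KervaireMilnor1963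
[crux] T(16), the TAIL / BRIDGE (tags UNDECIDED · DECLARED RESIDUAL · IDEA-NEEDED): every smooth
homotopy 4-sphere that is an R-link sphere at all is one for an R-link with ≤ 16 components in
regular position with ≤ 16 crossings. S-implied (S⁴ = Σ_∅); T(16) ⇒ #0377 only given F(16); #0377 ⇒
T(N) for all N; T monotone in N; T(∞) is general position (Reidemeister1932). Equivalent to: the
minimal R-link crossing number of GSC homotopy 4-spheres is bounded by 16 — finiteness and smallness
of 1-handle-free exotica; test = census M2 (certify all, or name the first resisting R-link = next
dial value). Critic verdict: DECLARED-RESIDUAL ≡ #0377 modulo F(16) (kernel gscStandard_iff_split;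
COSTUME-given-F relative to #0377, WEAKER-than-S by domination #0377 ⟹ T(N)) · UNDECIDED (test M2) ·
dial correction W2 accepted (raising N re-labels T and banks a larger finite theorem F(N); it does
not reduce the residual) — CLEARED decomp-sp4-crit-1-g0 2026-08-30T01:43:40Z; no seat asked. [deps:
SmallRLinkSpheresStandard] [difficulty: open-problem] -/
@[route_item "route-SmoothPoincare4-RootDecompD", crux]
def GscSpheresHaveSmallDiagrams : Prop :=
  open scoped ContDiff in ∀ (M : Type) [TopologicalSpace M] [T2Space M] [SecondCountableTopology M] [ChartedSpace (EuclideanSpace ℝ (Fin 4)) M] [IsManifold (𝓡 4) ∞ M], ContinuousMap.HomotopyEquiv M (Metric.sphere (0 : EuclideanSpace ℝ (Fin 5)) 1) → (∃ (n : ℕ) (L : Literature.Topology.FourManifolds.FramedLink (Fin n)), Literature.Topology.FourManifolds.IsRLinkSphere M L) → (∃ (n : ℕ) (L : Literature.Topology.FourManifolds.FramedLink (Fin n)) (γ : Fin n → ℝ → ℝ × ℝ) (C : Set ((Fin n × ℝ) × (Fin n × ℝ))), (∀ a t, γ a t = (((1 - (L.toLink.component a (Literature.Topology.FourManifolds.circlePoint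 t)).1 3)⁻¹ * (L.toLink.component a (Literature.Topology.FourManifolds.circlePoint t)).1 0), ((1 - (L.toLink.component a (Literature.Topology.FourManifolds.circlePoint t)).1 3)⁻¹ * (L.toLink.component a (Literature.Topology.FourManifolds.circlePoint t)).1 1))) ∧ C = {p | p.1 ≠ p.2 ∧ p.1.2 ∈ Set.Ico (0 : ℝ) (2 * Real.pi) ∧ p.2.2 ∈ Set.Ico (0 : ℝ) (2 * Real.pi) ∧ γ p.1.1 p.1.2 = γ p.2.1 p.2.2} ∧ n ≤ 16 ∧ (∀ a z, (L.toLink.component a z).1 3 ≠ 1) ∧ (∀ a t, deriv (γ a) t ≠ 0) ∧ C.Finite ∧ (∀ p ∈ C, (deriv (γ p.1.1) p.1.2).1 * (deriv (γ p.2.1) p.2.2).2 ≠ (deriv (γ p.1.1) p.1.2).2 * (deriv (γ p.2.1) p.2.2).1) ∧ C.ncard ≤ 32 ∧ Literature.Topology.FourManifolds.IsRLinkSphere M L)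

/-- item stmt-SmoothPoincare4-25269 · support · rank 9 · open · by planner
sources: GompfStipsicz1999, GompfScharlemannThompson2010, Milnor1963
[support] the Morse → handlebody bridge (lens W1; support, not a crux): a smooth homotopy 4-sphere
carrying a Morse function without index-1 critical points is an R-link sphere Σ_L for some framed
link L ⊂ S³ (handle decomposition from a generic Morse function, Milnor / GompfStipsicz1999 §4.2; no
1-handles ⇒ the 2-handles attach to B⁴ along a framed link whose trace has boundary #ⁿ S¹ × S², and
the 3/4-handles form a (0;n·1)-handlebody by χ = 2 — GompfScharlemannThompson2010 §9). S-implied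
trivially (S⁴ = Σ_∅: tree `isRLinkSphere_sphere_four_empty` + `IsRLinkSphere.of_diffeomorph`,
kernel-checked in the writer sketch). A textbook fact absent from the tree; provable by anyone idle
once `IsMorse`-to-handle-decomposition infrastructure exists. [difficulty: M] -/
@[route_item "route-SmoothPoincare4-RootDecompD", crux]
def MorseGscIsRLinkSphere : Prop :=
  ∀ S : Literature.Topology.FourManifolds.HomotopySphere 4, (∃ f : S.carrier → ℝ, Literature.Topology.FourManifolds.IsMorse (𝓡 4) f ∧ Literature.Topology.FourManifolds.criticalSetOfIndex (𝓡 4) f 1 = ∅) → ∃ (n : ℕ) (L : Literature.Topology.FourManifolds.FramedLink (Fin n)), Literature.Topology.FourManifolds.IsRLinkSphere S.carrier L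

/-- item stmt-SmoothPoincare4-25270 · assembly · rank 1 · open · by planner
sources: GompfScharlemannThompson2010
[assembly] NoOneHandlesExist → MorseGscIsRLinkSphere → SmallRLinkSpheresStandard →
GscSpheresHaveSmallDiagrams → _root_.SmoothPoincare4 (the type of the proved deciding theorem
closes). -/
@[route_item "route-SmoothPoincare4-RootDecompD"]
def Assembly : Prop :=
  NoOneHandlesExist → MorseGscIsRLinkSphere → SmallRLinkSpheresStandard → GscSpheresHaveSmallDiagrams → _root_.SmoothPoincare4

/-! D-0027 §2.1 — DECIDING THEOREM (planner-authored via `route open/edit --closes-file`; by planner-decomp-sp4-writer-1-g0-0 2026-08-30T02:29:15Z):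
its hypotheses are this route's items and its conclusion the sub-problem Statement (glue_lint), and it elaborates with this file. -/

@[closes "route-SmoothPoincare4-RootDecompD"] theorem closes (hC : NoOneHandlesExist) (hW : MorseGscIsRLinkSphere) (hF : SmallRLinkSpheresStandard)
    (hT : GscSpheresHaveSmallDiagrams) : _root_.SmoothPoincare4 := by
  intro M _ _ _ _ _ e
  haveI : CompactSpace M :=
    Literature.Topology.FourManifolds.compactSpace_of_homotopyEquiv_sphere_four_holds M e
  obtain ⟨o⟩ :=
    Literature.Topology.FourManifolds.isOrientable_of_homotopyEquiv_sphere_four_holds M e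
  exact hF M e (hT M e (hW ⟨M, o, ⟨e⟩⟩ (hC ⟨M, o, ⟨e⟩⟩)))

end Summit.SmoothPoincare4.SmoothPoincare4.Theses.RootDecompD
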